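import Summits.QuantumFields.YangMills.Theorems.EquipartitionCriticalityEquipartitionPinsProbeTangentDefs
import Literature.MathematicalPhysics.QuantumFieldTheory.LatticeGaugeProofs
import HarnessLib

/-!
# Uniform plaquette energy bound for torus-limit states

Crux `stmt-QuantumFields-8760` (`EquipartitionPinsProbe`), line `Sketch`, stub `stub_plaquetteEnergy` (TE)
of the reshaped `stub_tangentCore`.

Uniform equipartition at the origin — `β · E_μ[∑_{i<j} (N − Re tr ρ(U_{(0;i,j)}))]` is within `ε` of
`3D/2` eventually in `β`, uniformly over the torus-limit states `μ ∈ infiniteVolumeLimitPoints r.ρ β` —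
bounds the rescaled energy `β · E_μ[N − Re tr ρ(U_p)]` of EVERY single plaquette `p = (x; i<j)` by
`3D/2 + 1`, eventually in `β`, uniformly in `μ`:

* each term `N − Re tr ρ(U_p)` is `≥ 0` (`|Re tr ρ(U_p)| ≤ N` for unitary `ρ`, tree
  `abs_plaquetteObs_le_holds`), so a single plane is dominated by the site energy at `x`
  (`TangentPlaquetteEnergy.sub_plaquetteObs_le_siteSum`);
* the site energy at `x` under `μ` is the site energy at the origin under the translated state
  `μ ∘ θ_{-x}⁻¹`, which is again a torus-limit state (tree
  `map_configShift_mem_infiniteVolumeLimitPoints`), so the hypothesis with `ε = 1` applies to it;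
* integrability: `N − Re tr ρ(U_p)` is continuous (continuous `ρ`) hence measurable (the faithful
  representation makes `G` second countable) and bounded, and `μ` is a probability measure.

Reference: S. Chatterjee, arXiv:1803.01950, §2 (translation invariance of torus Wilson states,
`G ⊆ U(N)`).
-/

noncomputable section

open MeasureTheory Filter Topology
open Literature.MathematicalPhysics.QuantumLattice Literature.MathematicalPhysics.QuantumFieldTheory

namespace Summit.QuantumFields.YangMills.Theorems.EquipartitionPinsProbe

namespace TangentPlaquetteEnergy

variable {d N : ℕ} {G : Type*} [Group G] (ρ : G →* Matrix (Fin N) (Fin N) ℂ)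

/-- For unitary `ρ` the plaquette energy `N − Re tr ρ(U_p)` is non-negative. -/
theorem sub_plaquetteObs_nonneg (hρu : ∀ g, ρ g ∈ Matrix.unitaryGroup (Fin N) ℂ)
    (x : Literature.Probability.LatticeModels.Site d) (i j : Fin d) (U : LGConfig d G) :
    0 ≤ (N : ℝ) - plaquetteObs ρ x i j U :=
  sub_nonneg.2 (abs_le.1 (abs_plaquetteObs_le_holds ρ hρu x i j U)).2

/-- For unitary `ρ` the plaquette energy `N − Re tr ρ(U_p)` is at most `2N` in absolute value. -/
theorem abs_sub_plaquetteObs_le (hρu : ∀ g, ρ g ∈ Matrix.unitaryGroup (Fin N) ℂ)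
    (x : Literature.Probability.LatticeModels.Site d) (i j : Fin d) (U : LGConfig d G) :
    |(N : ℝ) - plaquetteObs ρ x i j U| ≤ 2 * N := by
  have h := abs_le.1 (abs_plaquetteObs_le_holds ρ hρu x i j U)
  rw [abs_le]
  constructor <;> linarith [h.1, h.2]

/-- A single plane is dominated by the site energy: for `i < j`,
`N − Re tr ρ(U_{(x;i,j)}) ≤ ∑_{i'<j'} (N − Re tr ρ(U_{(x;i',j')}))` (all terms are non-negative). -/
theorem sub_plaquetteObs_le_siteSum (hρu : ∀ g, ρ g ∈ Matrix.unitaryGroup (Fin N) ℂ)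
    (x : Literature.Probability.LatticeModels.Site d) {i j : Fin d} (hij : i < j) (U : LGConfig d G) :
    (N : ℝ) - plaquetteObs ρ x i j U ≤
      ∑ i' : Fin d, ∑ j' : Fin d, if i' < j' then ((N : ℝ) - plaquetteObs ρ x i' j' U) else 0 := by
  have hnn : ∀ i' j' : Fin d,
      0 ≤ (if i' < j' then ((N : ℝ) - plaquetteObs ρ x i' j' U) else 0) := fun i' j' => by
    split_ifs
    exacts [sub_plaquetteObs_nonneg ρ hρu x i' j' U, le_rfl]
  calc (N : ℝ) - plaquetteObs ρ x i j U
      = (if i < j then ((N : ℝ) - plaquetteObs ρ x i j U) else 0) := (if_pos hij).symm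
    _ ≤ ∑ j' : Fin d, if i < j' then ((N : ℝ) - plaquetteObs ρ x i j' U) else 0 :=
        Finset.single_le_sum
          (f := fun j' => if i < j' then ((N : ℝ) - plaquetteObs ρ x i j' U) else 0)
          (fun j' _ => hnn i j') (Finset.mem_univ j)
    _ ≤ ∑ i' : Fin d, ∑ j' : Fin d, if i' < j' then ((N : ℝ) - plaquetteObs ρ x i' j' U) else 0 :=
        Finset.single_le_sum
          (f := fun i' => ∑ j' : Fin d, if i' < j' then ((N : ℝ) - plaquetteObs ρ x i' j' U) else 0)
          (fun i' _ => Finset.sum_nonneg fun j' _ => hnn i' j') (Finset.mem_univ i)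

/-- Plaquette observables of a translated configuration: `O_{(x;i,j)}(θ_v U) = O_{(x−v;i,j)} U`. -/
theorem plaquetteObs_configShift [MeasurableSpace G] (v x : Literature.Probability.LatticeModels.Site d)
    (i j : Fin d) (U : LGConfig d G) :
    plaquetteObs ρ x i j (configShift v U) = plaquetteObs ρ (x - v) i j U := by
  simp only [plaquetteObs, plaquetteHolonomyZd, configShift_apply, add_sub_right_comm]

variable [TopologicalSpace G] [IsTopologicalGroup G] [MeasurableSpace G] [BorelSpace G]
  [SecondCountableTopology G]

/-- The plaquette energy `N − Re tr ρ(U_p)` is integrable for every finite measure on configurations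
(continuous unitary `ρ`, second countable `G`: bounded and measurable). -/
theorem integrable_sub_plaquetteObs (hρ : Continuous ρ) (hρu : ∀ g, ρ g ∈ Matrix.unitaryGroup (Fin N) ℂ)
    (μ : Measure (LGConfig d G)) [IsFiniteMeasure μ] (x : Literature.Probability.LatticeModels.Site d)
    (i j : Fin d) :
    Integrable (fun U => (N : ℝ) - plaquetteObs ρ x i j U) μ :=
  Integrable.of_bound (measurable_const.sub (measurable_plaquetteObs ρ hρ x i j)).aestronglyMeasurable
    (2 * N) (ae_of_all _ fun U => by
      rw [Real.norm_eq_abs]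
      exact abs_sub_plaquetteObs_le ρ hρu x i j U)

/-- The site energy `∑_{i<j} (N − Re tr ρ(U_{(x;i,j)}))` is integrable for every finite measure. -/
theorem integrable_siteSum (hρ : Continuous ρ) (hρu : ∀ g, ρ g ∈ Matrix.unitaryGroup (Fin N) ℂ)
    (μ : Measure (LGConfig d G)) [IsFiniteMeasure μ] (x : Literature.Probability.LatticeModels.Site d) :
    Integrable (fun U => ∑ i : Fin d, ∑ j : Fin d,
      if i < j then ((N : ℝ) - plaquetteObs ρ x i j U) else 0) μ := by
  refine integrable_finsetSum _ fun i _ => integrable_finsetSum _ fun j _ => ?_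
  by_cases hij : i < j <;> simp only [hij, ↓reduceIte]
  exacts [integrable_sub_plaquetteObs ρ hρ hρu μ x i j, integrable_const _]

end TangentPlaquetteEnergy

/-- STUB TE — **uniform plaquette energy bound**: uniform equipartition at the origin and translation
covariance of the torus-limit states (`map_configShift_mem_infiniteVolumeLimitPoints`) bound
`β E_μ[N − Re tr ρ(U_p)]` at every plaquette, eventually in `β`, uniformly over limit states. -/
theorem stub_plaquetteEnergy :
    ∀ (G : Type) [Group G] [TopologicalSpace G] [IsTopologicalGroup G] [CompactSpace G],
      Literature.MathematicalPhysics.QuantumFieldTheory.IsCompactSimpleLieGroup G →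
      letI : MeasurableSpace G := borel G
      haveI : BorelSpace G := ⟨rfl⟩
      ∀ r : Literature.MathematicalPhysics.QuantumFieldTheory.LatticeRep G,
        (∀ ε : ℝ, 0 < ε → ∀ᶠ β : ℝ in Filter.atTop,
          ∀ μ ∈ Literature.MathematicalPhysics.QuantumLattice.infiniteVolumeLimitPoints (d := 4) r.ρ β,
            |β * (∫ U, (∑ i : Fin 4, ∑ j : Fin 4,
                if i < j then ((r.N : ℝ) - Literature.MathematicalPhysics.QuantumLattice.plaquetteObs r.ρ 0 i j U) else 0) ∂μ) -
              3 * (Summit.QuantumFields.YangMills.Theorems.EquipartitionPinsProbe.lieDim r : ℝ) / 2| < ε) →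
        ∀ᶠ β : ℝ in Filter.atTop, ∀ μ ∈ Literature.MathematicalPhysics.QuantumLattice.infiniteVolumeLimitPoints (d := 4) r.ρ β,
          ∀ p : Literature.MathematicalPhysics.QuantumLattice.ZdPlaquette 4,
            MeasureTheory.Integrable (fun U => (r.N : ℝ) - Literature.MathematicalPhysics.QuantumLattice.plaquetteObs r.ρ p.1 p.2.1.1 p.2.1.2 U) μ ∧
            β * ∫ U, ((r.N : ℝ) - Literature.MathematicalPhysics.QuantumLattice.plaquetteObs r.ρ p.1 p.2.1.1 p.2.1.2 U) ∂μ ≤ 3 * (Summit.QuantumFields.YangMills.Theorems.EquipartitionPinsProbe.lieDim r : ℝ) / 2 + 1 := by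
  intro G _ _ _ _ _hG r hequi
  letI : MeasurableSpace G := borel G
  haveI : BorelSpace G := ⟨rfl⟩
  haveI : SecondCountableTopology G :=
    (r.continuous.isClosedEmbedding r.injective).isEmbedding.secondCountableTopology
  filter_upwards [hequi 1 one_pos, Filter.eventually_ge_atTop 0] with β hβ hβ0 μ hμ p
  haveI : IsProbabilityMeasure μ := by
    obtain ⟨L, -, hprob, -⟩ := hμ
    exact hprob
  have hint := TangentPlaquetteEnergy.integrable_sub_plaquetteObs r.ρ r.continuous r.mem_unitary μ
    p.1 p.2.1.1 p.2.1.2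
  refine ⟨hint, ?_⟩
  -- the translated state `μ ∘ θ_{-x}⁻¹` is a torus-limit state; apply equipartition with `ε = 1` to it
  have h1 := hβ _ (map_configShift_mem_infiniteVolumeLimitPoints r.ρ hμ (-p.1))
  rw [integral_map_equiv] at h1
  simp only [TangentPlaquetteEnergy.plaquetteObs_configShift, zero_sub, neg_neg] at h1
  have hmono : ∫ U, ((r.N : ℝ) - plaquetteObs r.ρ p.1 p.2.1.1 p.2.1.2 U) ∂μ ≤
      ∫ U, (∑ i : Fin 4, ∑ j : Fin 4,
        if i < j then ((r.N : ℝ) - plaquetteObs r.ρ p.1 i j U) else 0) ∂μ :=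
    integral_mono hint
      (TangentPlaquetteEnergy.integrable_siteSum r.ρ r.continuous r.mem_unitary μ p.1)
      fun U => TangentPlaquetteEnergy.sub_plaquetteObs_le_siteSum r.ρ r.mem_unitary p.1 p.2.2 U
  calc β * ∫ U, ((r.N : ℝ) - plaquetteObs r.ρ p.1 p.2.1.1 p.2.1.2 U) ∂μ
      ≤ β * ∫ U, (∑ i : Fin 4, ∑ j : Fin 4,
          if i < j then ((r.N : ℝ) - plaquetteObs r.ρ p.1 i j U) else 0) ∂μ :=
        mul_le_mul_of_nonneg_left hmono hβ0
    _ ≤ 3 * (lieDim r : ℝ) / 2 + 1 := by linarith [(abs_lt.1 h1).2]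

end Summit.QuantumFields.YangMills.Theorems.EquipartitionPinsProbe

end
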